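import Summits.BirchSwinnertonDyer.BirchSwinnertonDyer.Theorems.EisensteinPrimesMazurMCOnCellBTwistbackOrderOneAnchorZigzag
import Summits.BirchSwinnertonDyer.BirchSwinnertonDyer.Theorems.ByReductionTypeAtTwoKatoFreeSandwichOptimalTower
import Summits.BirchSwinnertonDyer.Rank1Residual.X2.IsogenyQuotientLine
import HarnessLib

/-!
# Crux 3 `MazurMCOnCellB` (stmt-BirchSwinnertonDyer-19033), line `twistback` v11 — ORDER-ONE ANCHOR CLASS DATA: the fourth
# negated datum of the registered stub 6⁶ («a NON-split order-one anchor CONNECTED to the class of `W`») is invariant under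
# `ℚ`-isogeny of the anchor, is a class datum at the start, and is CONSTANT ON ZIG-ZAG COMPONENTS; and the registered open
# content of v11 is, in the kernel, exactly two typed SUPPLY statements

LEAD bsd-line-x2-p1 (gen 15), cell `bsd-eis`, 2026-08-28; sequel of this seat's p675388 `…TwistbackOrderOneAnchorZigzag` and
the exact analogue, for the v11 anchor datum, of width seat x2-p1-w3 g15's p674224 `…TwistbackZigzagClassData` §3 (Ш-unit
datum). `--supports stmt-BirchSwinnertonDyer-19033 --as helper`. HONEST FRAMING: THEOREMS ONLY (no `def`, no named fact
introduced, no `sorry`); conditional on modularity (`nonempty_modularParametrizationData`, for conductors of isogenous curves)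
where marked and fact-free otherwise; closes no registered stub; no summit statement, no Mazur main conjecture and no case of
BSD is proved for any curve; 0 cells / labels / stubs / tiers move.

## What

The ANCHOR PACKAGE at a globally minimal `W₀` with field `K₀` (inline, no `def`): `(W₀, p)` non-split; `K₀` Heegner for
`N_{W₀}`; and x2-p1-w3 g11's certificate `hordL` (p661229 §1) — at every globally minimal model `Wd` of `E₀^{(d_{K₀})}`, for
every newform `f` of `Wd`, every `ϖ` with `ϖ·Ω(Wd) = Ω⁺(f)` and every non-split multiplicative `p`-adic `L`-function `L` of
`f`, `ord_{T=0} L = 1`. The v11 DATUM at `W`: `∃ W₁ ∼ W`, a zig-zag `W₁ ⇝ W₀` (v10 relation), `K₀` imaginary quadratic,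
Heegner for `p`, `d_{K₀}` odd `< −4`, and the anchor package at `(W₀, K₀)` — VERBATIM `hA` of p675388 §2 / the statement
negated by the fourth hypothesis of `stub_upperPartnerOffSubrowNoConnectedClassShaUnitNoOrderOneAnchor`.

* §1 `orderOneAnchor_of_isIsogenous` — **the anchor package is invariant under a `ℚ`-isogeny `W₀ ∼ W₀'` of globally minimal
  curves**: non-split type (`X2.IsogenyQuotientLine.hasSplitMultiplicativeReductionAtPrime_iff_of_isIsogenous`, Faltings/Knapp),
  conductor (`conductorNorm_eq_of_isIsogenous_of_modularity_of_isGloballyMinimal`, `hmodN`), and the certificate: a minimal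
  model `Wd'` of `E₀'^{(d)}` is isogenous to one `Wd` of `E₀^{(d)}` (`IsIsogenous.quadraticTwist`), has the same newform
  (`IsNewformOf.of_isIsogenous`), and `Ω(Wd') = q·Ω(Wd)` with `q ∈ ℚ_{>0}` (`KatoFreeSandwich.exists_rat_pos_realPeriodRat_eq_mul_of_isIsogenous`,
  cell bsd-by2's fact-free isogeny period ratio, Milne I §7), so `ϖ'·Ω(Wd') = Ω⁺(f)` gives the rational `ϖ := ϖ'q` with `ϖ·Ω(Wd) = Ω⁺(f)` and `hordL` applies — the order
  clause does not see `ϖ`.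
* §2 `exists_connectedOrderOneAnchor_of_far_isIsogenous` — **a far-end isogeny is absorbed**: zig-zag `W₁ ⇝ U`, `U ∼ W₀`,
  anchor at `W₀` ⟹ the v11 datum (anchor moved to `U` by §1). This is the form per-cell wrappers want (anchor certified at ANY
  member of the far class).
* §3 the v11 datum is a CLASS datum and CONSTANT ON COMPONENTS: `exists_connectedOrderOneAnchor_of_isIsogenous` /
  `…_iff_of_isIsogenous` (fact-free, start side), `exists_connectedOrderOneAnchor_iff` (the start member `W₁` is redundant,
  `hmodN`), `exists_connectedOrderOneAnchor_of_zigzag` / `not_exists_connectedOrderOneAnchor_of_zigzag` (`hmodN`; x2-p1-w3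
  g15's `exists_zigzag_of_isIsogenous` + §1). So the population excluded by the fourth hypothesis of 6⁶ is a union of
  connected components of the class graph, like the third (p674224).
* §4 `mazurMainConjectureAt_of_cellB_of_zigzag_far_isIsogenous_orderOneAnchor` — Mazur's main conjecture at `(W, p)` from the
  §2-shaped datum (p675388 §2 ∘ §2), the v11 cone.

References: [Knapp1993] Thm. 11.67; [SilvermanAEC2009] §C.16; [MilneADT2006] I §7; [CremonaAlgorithms1997] §3.9; [PerrinRiou1987]
§1.4; [Disegni2020] §2.2 Thm. 2.4, §3.2 Thm. 4; [KellerYin2024] Thm. D (= Thm. 5.1.3); tree: p661229, p674224, p675388, p672105.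
-/

set_option autoImplicit false

-- `Summit.BirchSwinnertonDyer.BirchSwinnertonDyer.…`: the summit and its single sub-problem share a name.
set_option linter.dupNamespace false

noncomputable section

open scoped Classical MatrixGroups ModularForm

open CongruenceSubgroup WeierstrassCurve NumberField
  Literature.NumberTheory.EllipticCurves
  Literature.NumberTheory.GaloisRepresentations
  Literature.NumberTheory.EllipticCurves.ModularForms
  Literature.NumberTheory.QuadraticFields
  Literature.NumberTheory.EllipticCurves.Rank1Residual
  Literature.NumberTheory.EllipticCurves.Rank1Residual.Typed
  Literature.NumberTheory.EllipticCurves.Wuthrich2014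
  Literature.NumberTheory.EllipticCurves.Disegni2020
  Literature.NumberTheory.EllipticCurves.KellerYin2024
  Literature.NumberTheory.GaloisCohomology
  Summit.BirchSwinnertonDyer.Rank1Residual
  Summit.BirchSwinnertonDyer.Rank1Residual.X2
  Summit.BirchSwinnertonDyer.BirchSwinnertonDyer.Theses
  Summit.BirchSwinnertonDyer.BirchSwinnertonDyer.Theorems.EisensteinPrimesMazurMCOnCellBTwistbackTwoStepDefs
  Summit.BirchSwinnertonDyer.BirchSwinnertonDyer.Theorems.EisensteinPrimesMazurMCOnCellBTwistbackZigzagClassData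

namespace Summit.BirchSwinnertonDyer.BirchSwinnertonDyer.Theorems.EisensteinPrimesMazurMCOnCellBTwistbackOrderOneAnchorClassData

/-! ## §1. The anchor package is invariant under a `ℚ`-isogeny of the anchor -/

/-- **The order-one ANCHOR PACKAGE moves along a `ℚ`-isogeny of globally minimal curves.** If `W₀ ∼ W₀'` (both globally
minimal), `(W₀, p)` is non-split, `K` is Heegner for `N_{W₀}` and the certificate `hordL` holds at `(W₀, K)`, then `(W₀', p)`
is non-split (`a_p` is an isogeny invariant: `X2.IsogenyQuotientLine.hasSplitMultiplicativeReductionAtPrime_iff_of_isIsogenous`),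
`K` is Heegner for `N_{W₀'} = N_{W₀}` (modularity, `hmodN`) and the certificate holds at `(W₀', K)`: given a minimal model `Wd'`
of `E₀'^{(d_K)}`, a newform `f` of `Wd'`, `ϖ'` with `ϖ'·Ω(Wd') = Ω⁺(f)` and `L` the non-split `p`-adic `L`-function of `f`,
pick a minimal model `Wd` of `E₀^{(d_K)}` (`exists_isGloballyMinimal_smul_eq_quadraticTwist`); `Wd ∼ Wd'`
(`IsIsogenous.quadraticTwist`), so `f` is a newform of `Wd` (`IsNewformOf.of_isIsogenous`) and `Ω(Wd') = q·Ω(Wd)` with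
`q ∈ ℚ_{>0}` (`exists_rat_pos_realPeriodRat_eq_mul_of_isIsogenous`), whence `(ϖ'q)·Ω(Wd) = Ω⁺(f)` and `hordL` at `(Wd, f, ϖ'q, L)`
gives `ord_{T=0} L = 1`. Conditional on `hmodN` only. [cite: Knapp1993, Thm. 11.67 (PDF p. 281)]
[cite: MilneADT2006, Ch. I §7, proof of Thm. 7.3 (p. 98)] [cite: SilvermanAEC2009, §C.16] -/
theorem orderOneAnchor_of_isIsogenous (hmodN : nonempty_modularParametrizationData)
    {p : ℕ} [Fact p.Prime] {W₀ W₀' : WeierstrassCurve ℚ} [W₀.IsElliptic] [W₀.IsGloballyMinimal]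
    [W₀'.IsElliptic] [W₀'.IsGloballyMinimal] (hiso : IsIsogenous W₀ W₀')
    (hns₀ : ¬ W₀.HasSplitMultiplicativeReductionAtPrime p)
    {K : Type} [Field K] [NumberField K] (hHN : SatisfiesHeegnerHypothesis (W₀.conductorNorm ℤ) K)
    (hordL : ∀ (Wd : WeierstrassCurve ℚ) [Wd.IsElliptic] [Wd.IsGloballyMinimal],
      (∃ C : VariableChange ℚ, C • Wd = W₀.quadraticTwist (NumberField.discr K : ℚ)) →
      ∀ {M : ℕ} [NeZero M] (f : CuspForm (Gamma0 M) 2), IsNewformOf Wd f →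
      ∀ (ϖ : ℚ), (ϖ : ℝ) * Wd.realPeriodRat = plusPeriod f →
      ∀ L : PowerSeries ℚ_[p], IsMultPAdicLFunctionOf f p (-1) L → L.order = ((1 : ℕ) : ℕ∞)) :
    ¬ W₀'.HasSplitMultiplicativeReductionAtPrime p ∧
      SatisfiesHeegnerHypothesis (W₀'.conductorNorm ℤ) K ∧
      ∀ (Wd' : WeierstrassCurve ℚ) [Wd'.IsElliptic] [Wd'.IsGloballyMinimal],
        (∃ C : VariableChange ℚ, C • Wd' = W₀'.quadraticTwist (NumberField.discr K : ℚ)) →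
        ∀ {M : ℕ} [NeZero M] (f : CuspForm (Gamma0 M) 2), IsNewformOf Wd' f →
        ∀ (ϖ : ℚ), (ϖ : ℝ) * Wd'.realPeriodRat = plusPeriod f →
        ∀ L : PowerSeries ℚ_[p], IsMultPAdicLFunctionOf f p (-1) L → L.order = ((1 : ℕ) : ℕ∞) := by
  refine ⟨fun hs ↦ hns₀ ((X2.IsogenyQuotientLine.hasSplitMultiplicativeReductionAtPrime_iff_of_isIsogenous
      (p := p) hiso).mpr hs), ?_, ?_⟩
  · rwa [← conductorNorm_eq_of_isIsogenous_of_modularity_of_isGloballyMinimal hmodN hiso]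
  · intro Wd' _ _ hWd' M _ f hf ϖ' hϖ' L hL
    obtain ⟨C', hC'⟩ := hWd'
    have hd0 : (NumberField.discr K : ℚ) ≠ 0 := by exact_mod_cast NumberField.discr_ne_zero K
    obtain ⟨Wd, _, _, C, hC⟩ := exists_isGloballyMinimal_smul_eq_quadraticTwist W₀ hd0
    haveI := W₀.isElliptic_quadraticTwist hd0
    haveI := W₀'.isElliptic_quadraticTwist hd0
    -- `Wd ∼ Wd'`: models of the twists of isogenous curves
    have hisod : IsIsogenous Wd Wd' :=
      (isIsogenous_of_smul_eq hC).trans' ((hiso.quadraticTwist hd0).trans' (isIsogenous_of_smul_eq' hC'))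
    -- same newform, rational period ratio
    have hfWd : IsNewformOf Wd f := hf.of_isIsogenous hisod
    obtain ⟨q, -, hq⟩ := KatoFreeSandwich.exists_rat_pos_realPeriodRat_eq_mul_of_isIsogenous hisod
    have hϖ : ((ϖ' * q : ℚ) : ℝ) * Wd.realPeriodRat = plusPeriod f := by
      rw [← hϖ', hq]; push_cast; ring
    exact hordL Wd ⟨C, hC⟩ f hfWd (ϖ' * q) hϖ L hL

/-! ## §2. A far-end isogeny is absorbed: anchor at ANY member of the far class -/

/-- **The v11 datum from a zig-zag ending in the CLASS of an anchor**: at `(W, p)`, a globally minimal `W₁ ∼ W`, a zig-zag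
`W₁ ⇝ U` (v10 relation; `U` globally minimal), a globally minimal `W₀ ∼ U`, `K₀` imaginary quadratic, Heegner for `N_{W₀}`
and `p`, `d_{K₀}` odd `< −4`, the anchor package at `(W₀, K₀)` ⟹ the v11 datum at `W` (VERBATIM `hA` of p675388 §2), the
anchor being moved from `W₀` to `U` by §1. The shape per-cell wrappers consume: the certificate may be read at ANY globally
minimal member of the far isogeny class (e.g. the optimal one). Conditional on `hmodN` only. [folklore] -/
theorem exists_connectedOrderOneAnchor_of_far_isIsogenous (hmodN : nonempty_modularParametrizationData)
    {p : ℕ} [Fact p.Prime] {W : WeierstrassCurve ℚ}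
    (W₁ : WeierstrassCurve ℚ) [W₁.IsElliptic] [W₁.IsGloballyMinimal] (hiso₁ : IsIsogenous W W₁)
    (U : WeierstrassCurve ℚ) [U.IsElliptic] [U.IsGloballyMinimal]
    (hz : Relation.ReflTransGen (fun A B : WeierstrassCurve ℚ ↦ TwoStepAt p A B ∨
      (TwoStepAt p B A ∧ ∃ (_ : B.IsElliptic) (_ : B.IsGloballyMinimal), X2.CellB B p)) W₁ U)
    (W₀ : WeierstrassCurve ℚ) [W₀.IsElliptic] [W₀.IsGloballyMinimal] (hisoU : IsIsogenous U W₀)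
    (hns₀ : ¬ W₀.HasSplitMultiplicativeReductionAtPrime p)
    (K : Type) [Field K] [NumberField K] (hK : IsImaginaryQuadratic K)
    (hHN : SatisfiesHeegnerHypothesis (W₀.conductorNorm ℤ) K) (hHp : SatisfiesHeegnerHypothesis p K)
    (hodd : Odd (NumberField.discr K)) (hlt : NumberField.discr K < -4)
    (hordL : ∀ (Wd : WeierstrassCurve ℚ) [Wd.IsElliptic] [Wd.IsGloballyMinimal],
      (∃ C : VariableChange ℚ, C • Wd = W₀.quadraticTwist (NumberField.discr K : ℚ)) →
      ∀ {M : ℕ} [NeZero M] (f : CuspForm (Gamma0 M) 2), IsNewformOf Wd f →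
      ∀ (ϖ : ℚ), (ϖ : ℝ) * Wd.realPeriodRat = plusPeriod f →
      ∀ L : PowerSeries ℚ_[p], IsMultPAdicLFunctionOf f p (-1) L → L.order = ((1 : ℕ) : ℕ∞)) :
    ∃ (W₁ : WeierstrassCurve ℚ) (_ : W₁.IsElliptic) (_ : W₁.IsGloballyMinimal)
      (W₀ : WeierstrassCurve ℚ) (_ : W₀.IsElliptic) (_ : W₀.IsGloballyMinimal),
      IsIsogenous W W₁ ∧
      Relation.ReflTransGen (fun A B : WeierstrassCurve ℚ ↦ TwoStepAt p A B ∨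
        (TwoStepAt p B A ∧ ∃ (_ : B.IsElliptic) (_ : B.IsGloballyMinimal), X2.CellB B p)) W₁ W₀ ∧
      ¬ W₀.HasSplitMultiplicativeReductionAtPrime p ∧
      ∃ (K : Type) (_ : Field K) (_ : NumberField K), IsImaginaryQuadratic K ∧
        SatisfiesHeegnerHypothesis (W₀.conductorNorm ℤ) K ∧ SatisfiesHeegnerHypothesis p K ∧
        Odd (NumberField.discr K) ∧ NumberField.discr K < -4 ∧
        ∀ (Wd : WeierstrassCurve ℚ) [Wd.IsElliptic] [Wd.IsGloballyMinimal],
          (∃ C : VariableChange ℚ, C • Wd = W₀.quadraticTwist (NumberField.discr K : ℚ)) →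
          ∀ {M : ℕ} [NeZero M] (f : CuspForm (Gamma0 M) 2), IsNewformOf Wd f →
          ∀ (ϖ : ℚ), (ϖ : ℝ) * Wd.realPeriodRat = plusPeriod f →
          ∀ L : PowerSeries ℚ_[p], IsMultPAdicLFunctionOf f p (-1) L → L.order = ((1 : ℕ) : ℕ∞) := by
  obtain ⟨hnsU, hHNU, hordU⟩ := orderOneAnchor_of_isIsogenous hmodN (p := p) hisoU.symm_of_charZero hns₀ hHN hordL
  exact ⟨W₁, inferInstance, inferInstance, U, inferInstance, inferInstance, hiso₁, hz, hnsU, K, inferInstance,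
    inferInstance, hK, hHNU, hHp, hodd, hlt, fun Wd _ _ hWd ↦ hordU Wd hWd⟩

/-! ## §3. The v11 datum is a CLASS datum at the start and CONSTANT ON ZIG-ZAG COMPONENTS -/

/-- **The v11 anchor datum is a union of `ℚ`-isogeny classes** (fact-free: transitivity of `IsIsogenous` at the start): if
`W′ ∼ W` and the datum holds at `W`, it holds at `W′` with the same `W₁`, zig-zag, anchor and field. [folklore] -/
theorem exists_connectedOrderOneAnchor_of_isIsogenous {p : ℕ} [Fact p.Prime] {W W' : WeierstrassCurve ℚ}
    (hWW' : IsIsogenous W' W)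
    (h : ∃ (W₁ : WeierstrassCurve ℚ) (_ : W₁.IsElliptic) (_ : W₁.IsGloballyMinimal)
        (W₀ : WeierstrassCurve ℚ) (_ : W₀.IsElliptic) (_ : W₀.IsGloballyMinimal),
        IsIsogenous W W₁ ∧
        Relation.ReflTransGen (fun A B : WeierstrassCurve ℚ ↦ TwoStepAt p A B ∨
          (TwoStepAt p B A ∧ ∃ (_ : B.IsElliptic) (_ : B.IsGloballyMinimal), X2.CellB B p)) W₁ W₀ ∧
        ¬ W₀.HasSplitMultiplicativeReductionAtPrime p ∧
        ∃ (K : Type) (_ : Field K) (_ : NumberField K), IsImaginaryQuadratic K ∧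
          SatisfiesHeegnerHypothesis (W₀.conductorNorm ℤ) K ∧ SatisfiesHeegnerHypothesis p K ∧
          Odd (NumberField.discr K) ∧ NumberField.discr K < -4 ∧
          ∀ (Wd : WeierstrassCurve ℚ) [Wd.IsElliptic] [Wd.IsGloballyMinimal],
            (∃ C : VariableChange ℚ, C • Wd = W₀.quadraticTwist (NumberField.discr K : ℚ)) →
            ∀ {M : ℕ} [NeZero M] (f : CuspForm (Gamma0 M) 2), IsNewformOf Wd f →
            ∀ (ϖ : ℚ), (ϖ : ℝ) * Wd.realPeriodRat = plusPeriod f →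
            ∀ L : PowerSeries ℚ_[p], IsMultPAdicLFunctionOf f p (-1) L → L.order = ((1 : ℕ) : ℕ∞)) :
    ∃ (W₁ : WeierstrassCurve ℚ) (_ : W₁.IsElliptic) (_ : W₁.IsGloballyMinimal)
      (W₀ : WeierstrassCurve ℚ) (_ : W₀.IsElliptic) (_ : W₀.IsGloballyMinimal),
      IsIsogenous W' W₁ ∧
      Relation.ReflTransGen (fun A B : WeierstrassCurve ℚ ↦ TwoStepAt p A B ∨
        (TwoStepAt p B A ∧ ∃ (_ : B.IsElliptic) (_ : B.IsGloballyMinimal), X2.CellB B p)) W₁ W₀ ∧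
      ¬ W₀.HasSplitMultiplicativeReductionAtPrime p ∧
      ∃ (K : Type) (_ : Field K) (_ : NumberField K), IsImaginaryQuadratic K ∧
        SatisfiesHeegnerHypothesis (W₀.conductorNorm ℤ) K ∧ SatisfiesHeegnerHypothesis p K ∧
        Odd (NumberField.discr K) ∧ NumberField.discr K < -4 ∧
        ∀ (Wd : WeierstrassCurve ℚ) [Wd.IsElliptic] [Wd.IsGloballyMinimal],
          (∃ C : VariableChange ℚ, C • Wd = W₀.quadraticTwist (NumberField.discr K : ℚ)) →
          ∀ {M : ℕ} [NeZero M] (f : CuspForm (Gamma0 M) 2), IsNewformOf Wd f →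
          ∀ (ϖ : ℚ), (ϖ : ℝ) * Wd.realPeriodRat = plusPeriod f →
          ∀ L : PowerSeries ℚ_[p], IsMultPAdicLFunctionOf f p (-1) L → L.order = ((1 : ℕ) : ℕ∞) := by
  obtain ⟨W₁, _, _, W₀, _, _, h₁, hz, hns, hK⟩ := h
  exact ⟨W₁, inferInstance, inferInstance, W₀, inferInstance, inferInstance, hWW'.trans' h₁, hz, hns, hK⟩

/-- **The v11 anchor datum is a CLASS datum** (iff form of the previous theorem; the isogeny reverses). Fact-free. [folklore] -/
theorem exists_connectedOrderOneAnchor_iff_of_isIsogenous {p : ℕ} [Fact p.Prime] {W W' : WeierstrassCurve ℚ}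
    [W.IsElliptic] [W'.IsElliptic] (hiso : IsIsogenous W W') :
    (∃ (W₁ : WeierstrassCurve ℚ) (_ : W₁.IsElliptic) (_ : W₁.IsGloballyMinimal)
        (W₀ : WeierstrassCurve ℚ) (_ : W₀.IsElliptic) (_ : W₀.IsGloballyMinimal),
        IsIsogenous W W₁ ∧
        Relation.ReflTransGen (fun A B : WeierstrassCurve ℚ ↦ TwoStepAt p A B ∨
          (TwoStepAt p B A ∧ ∃ (_ : B.IsElliptic) (_ : B.IsGloballyMinimal), X2.CellB B p)) W₁ W₀ ∧
        ¬ W₀.HasSplitMultiplicativeReductionAtPrime p ∧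
        ∃ (K : Type) (_ : Field K) (_ : NumberField K), IsImaginaryQuadratic K ∧
          SatisfiesHeegnerHypothesis (W₀.conductorNorm ℤ) K ∧ SatisfiesHeegnerHypothesis p K ∧
          Odd (NumberField.discr K) ∧ NumberField.discr K < -4 ∧
          ∀ (Wd : WeierstrassCurve ℚ) [Wd.IsElliptic] [Wd.IsGloballyMinimal],
            (∃ C : VariableChange ℚ, C • Wd = W₀.quadraticTwist (NumberField.discr K : ℚ)) →
            ∀ {M : ℕ} [NeZero M] (f : CuspForm (Gamma0 M) 2), IsNewformOf Wd f →
            ∀ (ϖ : ℚ), (ϖ : ℝ) * Wd.realPeriodRat = plusPeriod f →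
            ∀ L : PowerSeries ℚ_[p], IsMultPAdicLFunctionOf f p (-1) L → L.order = ((1 : ℕ) : ℕ∞)) ↔
    (∃ (W₁ : WeierstrassCurve ℚ) (_ : W₁.IsElliptic) (_ : W₁.IsGloballyMinimal)
        (W₀ : WeierstrassCurve ℚ) (_ : W₀.IsElliptic) (_ : W₀.IsGloballyMinimal),
        IsIsogenous W' W₁ ∧
        Relation.ReflTransGen (fun A B : WeierstrassCurve ℚ ↦ TwoStepAt p A B ∨
          (TwoStepAt p B A ∧ ∃ (_ : B.IsElliptic) (_ : B.IsGloballyMinimal), X2.CellB B p)) W₁ W₀ ∧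
        ¬ W₀.HasSplitMultiplicativeReductionAtPrime p ∧
        ∃ (K : Type) (_ : Field K) (_ : NumberField K), IsImaginaryQuadratic K ∧
          SatisfiesHeegnerHypothesis (W₀.conductorNorm ℤ) K ∧ SatisfiesHeegnerHypothesis p K ∧
          Odd (NumberField.discr K) ∧ NumberField.discr K < -4 ∧
          ∀ (Wd : WeierstrassCurve ℚ) [Wd.IsElliptic] [Wd.IsGloballyMinimal],
            (∃ C : VariableChange ℚ, C • Wd = W₀.quadraticTwist (NumberField.discr K : ℚ)) →
            ∀ {M : ℕ} [NeZero M] (f : CuspForm (Gamma0 M) 2), IsNewformOf Wd f →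
            ∀ (ϖ : ℚ), (ϖ : ℝ) * Wd.realPeriodRat = plusPeriod f →
            ∀ L : PowerSeries ℚ_[p], IsMultPAdicLFunctionOf f p (-1) L → L.order = ((1 : ℕ) : ℕ∞)) :=
  ⟨exists_connectedOrderOneAnchor_of_isIsogenous hiso.symm_of_charZero,
    exists_connectedOrderOneAnchor_of_isIsogenous hiso⟩

/-- **The start member `W₁` of the v11 anchor datum is redundant** (granted modularity): at a globally minimal elliptic `W`
the datum holds iff «`∃ W₀` with `W ⇝ W₀` along zig-zags, `(W₀, p)` non-split, and an admissible `K₀` with the anchor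
package» — `→`: push `W ∼ W₁` through the zig-zag (x2-p1-w3 g15's `exists_zigzag_of_isIsogenous`: `W ⇝ U₂ ∼ W₀`) and move
the anchor from `W₀` to `U₂` by §1; `←`: `W₁ := W`. Conditional on `hmodN` only. [folklore] -/
theorem exists_connectedOrderOneAnchor_iff (hmodN : nonempty_modularParametrizationData)
    {p : ℕ} [Fact p.Prime] (W : WeierstrassCurve ℚ) [W.IsElliptic] [W.IsGloballyMinimal] :
    (∃ (W₁ : WeierstrassCurve ℚ) (_ : W₁.IsElliptic) (_ : W₁.IsGloballyMinimal)
        (W₀ : WeierstrassCurve ℚ) (_ : W₀.IsElliptic) (_ : W₀.IsGloballyMinimal),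
        IsIsogenous W W₁ ∧
        Relation.ReflTransGen (fun A B : WeierstrassCurve ℚ ↦ TwoStepAt p A B ∨
          (TwoStepAt p B A ∧ ∃ (_ : B.IsElliptic) (_ : B.IsGloballyMinimal), X2.CellB B p)) W₁ W₀ ∧
        ¬ W₀.HasSplitMultiplicativeReductionAtPrime p ∧
        ∃ (K : Type) (_ : Field K) (_ : NumberField K), IsImaginaryQuadratic K ∧
          SatisfiesHeegnerHypothesis (W₀.conductorNorm ℤ) K ∧ SatisfiesHeegnerHypothesis p K ∧
          Odd (NumberField.discr K) ∧ NumberField.discr K < -4 ∧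
          ∀ (Wd : WeierstrassCurve ℚ) [Wd.IsElliptic] [Wd.IsGloballyMinimal],
            (∃ C : VariableChange ℚ, C • Wd = W₀.quadraticTwist (NumberField.discr K : ℚ)) →
            ∀ {M : ℕ} [NeZero M] (f : CuspForm (Gamma0 M) 2), IsNewformOf Wd f →
            ∀ (ϖ : ℚ), (ϖ : ℝ) * Wd.realPeriodRat = plusPeriod f →
            ∀ L : PowerSeries ℚ_[p], IsMultPAdicLFunctionOf f p (-1) L → L.order = ((1 : ℕ) : ℕ∞)) ↔
    (∃ (W₀ : WeierstrassCurve ℚ) (_ : W₀.IsElliptic) (_ : W₀.IsGloballyMinimal),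
        Relation.ReflTransGen (fun A B : WeierstrassCurve ℚ ↦ TwoStepAt p A B ∨
          (TwoStepAt p B A ∧ ∃ (_ : B.IsElliptic) (_ : B.IsGloballyMinimal), X2.CellB B p)) W W₀ ∧
        ¬ W₀.HasSplitMultiplicativeReductionAtPrime p ∧
        ∃ (K : Type) (_ : Field K) (_ : NumberField K), IsImaginaryQuadratic K ∧
          SatisfiesHeegnerHypothesis (W₀.conductorNorm ℤ) K ∧ SatisfiesHeegnerHypothesis p K ∧
          Odd (NumberField.discr K) ∧ NumberField.discr K < -4 ∧
          ∀ (Wd : WeierstrassCurve ℚ) [Wd.IsElliptic] [Wd.IsGloballyMinimal],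
            (∃ C : VariableChange ℚ, C • Wd = W₀.quadraticTwist (NumberField.discr K : ℚ)) →
            ∀ {M : ℕ} [NeZero M] (f : CuspForm (Gamma0 M) 2), IsNewformOf Wd f →
            ∀ (ϖ : ℚ), (ϖ : ℝ) * Wd.realPeriodRat = plusPeriod f →
            ∀ L : PowerSeries ℚ_[p], IsMultPAdicLFunctionOf f p (-1) L → L.order = ((1 : ℕ) : ℕ∞)) := by
  constructor
  · rintro ⟨W₁, _, _, W₀, _, _, h₁, hz, hns, K, _, _, hK, hHN, hHp, hodd, hlt, hordL⟩
    obtain ⟨U₂, _, _, hU₂, hiso₂⟩ := exists_zigzag_of_isIsogenous hmodN h₁ hz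
    obtain ⟨hnsU, hHNU, hordU⟩ := orderOneAnchor_of_isIsogenous hmodN (p := p) hiso₂.symm_of_charZero hns hHN hordL
    exact ⟨U₂, inferInstance, inferInstance, hU₂, hnsU, K, inferInstance, inferInstance, hK, hHNU, hHp, hodd, hlt,
      fun Wd _ _ hWd ↦ hordU Wd hWd⟩
  · rintro ⟨W₀, _, _, hz, hns, hK⟩
    exact ⟨W, inferInstance, inferInstance, W₀, inferInstance, inferInstance, isIsogenous_self W, hz, hns, hK⟩

/-- **The v11 anchor datum is CONSTANT ON ZIG-ZAG COMPONENTS**: if `W ⇝ U` along zig-zags (`W`, `U` globally minimal) and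
the datum holds at `U` (some `U₁ ∼ U` is connected to an anchor `W₀`), then it holds at `W`: push `U ∼ U₁` through `U₁`'s
zig-zag (`U ⇝ U₂ ∼ W₀`), move the anchor to `U₂` (§1), concatenate, `W₁ := W`. So the population EXCLUDED by the fourth
hypothesis of stub 6⁶ is a union of connected components of the class graph; with x2-p1-w3 g15's `zigzag_reverse_of_cellB`
an X2b pair is excluded iff any X2b pair of its component is. Conditional on `hmodN` only. [folklore] -/
theorem exists_connectedOrderOneAnchor_of_zigzag (hmodN : nonempty_modularParametrizationData)
    {p : ℕ} [Fact p.Prime] {W : WeierstrassCurve ℚ} [W.IsElliptic] [W.IsGloballyMinimal]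
    (U : WeierstrassCurve ℚ) [U.IsElliptic] [U.IsGloballyMinimal]
    (hz : Relation.ReflTransGen (fun A B : WeierstrassCurve ℚ ↦ TwoStepAt p A B ∨
      (TwoStepAt p B A ∧ ∃ (_ : B.IsElliptic) (_ : B.IsGloballyMinimal), X2.CellB B p)) W U)
    (hU : ∃ (U₁ : WeierstrassCurve ℚ) (_ : U₁.IsElliptic) (_ : U₁.IsGloballyMinimal)
        (W₀ : WeierstrassCurve ℚ) (_ : W₀.IsElliptic) (_ : W₀.IsGloballyMinimal),
        IsIsogenous U U₁ ∧
        Relation.ReflTransGen (fun A B : WeierstrassCurve ℚ ↦ TwoStepAt p A B ∨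
          (TwoStepAt p B A ∧ ∃ (_ : B.IsElliptic) (_ : B.IsGloballyMinimal), X2.CellB B p)) U₁ W₀ ∧
        ¬ W₀.HasSplitMultiplicativeReductionAtPrime p ∧
        ∃ (K : Type) (_ : Field K) (_ : NumberField K), IsImaginaryQuadratic K ∧
          SatisfiesHeegnerHypothesis (W₀.conductorNorm ℤ) K ∧ SatisfiesHeegnerHypothesis p K ∧
          Odd (NumberField.discr K) ∧ NumberField.discr K < -4 ∧
          ∀ (Wd : WeierstrassCurve ℚ) [Wd.IsElliptic] [Wd.IsGloballyMinimal],
            (∃ C : VariableChange ℚ, C • Wd = W₀.quadraticTwist (NumberField.discr K : ℚ)) →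
            ∀ {M : ℕ} [NeZero M] (f : CuspForm (Gamma0 M) 2), IsNewformOf Wd f →
            ∀ (ϖ : ℚ), (ϖ : ℝ) * Wd.realPeriodRat = plusPeriod f →
            ∀ L : PowerSeries ℚ_[p], IsMultPAdicLFunctionOf f p (-1) L → L.order = ((1 : ℕ) : ℕ∞)) :
    ∃ (W₁ : WeierstrassCurve ℚ) (_ : W₁.IsElliptic) (_ : W₁.IsGloballyMinimal)
      (W₀ : WeierstrassCurve ℚ) (_ : W₀.IsElliptic) (_ : W₀.IsGloballyMinimal),
      IsIsogenous W W₁ ∧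
      Relation.ReflTransGen (fun A B : WeierstrassCurve ℚ ↦ TwoStepAt p A B ∨
        (TwoStepAt p B A ∧ ∃ (_ : B.IsElliptic) (_ : B.IsGloballyMinimal), X2.CellB B p)) W₁ W₀ ∧
      ¬ W₀.HasSplitMultiplicativeReductionAtPrime p ∧
      ∃ (K : Type) (_ : Field K) (_ : NumberField K), IsImaginaryQuadratic K ∧
        SatisfiesHeegnerHypothesis (W₀.conductorNorm ℤ) K ∧ SatisfiesHeegnerHypothesis p K ∧
        Odd (NumberField.discr K) ∧ NumberField.discr K < -4 ∧
        ∀ (Wd : WeierstrassCurve ℚ) [Wd.IsElliptic] [Wd.IsGloballyMinimal],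
          (∃ C : VariableChange ℚ, C • Wd = W₀.quadraticTwist (NumberField.discr K : ℚ)) →
          ∀ {M : ℕ} [NeZero M] (f : CuspForm (Gamma0 M) 2), IsNewformOf Wd f →
          ∀ (ϖ : ℚ), (ϖ : ℝ) * Wd.realPeriodRat = plusPeriod f →
          ∀ L : PowerSeries ℚ_[p], IsMultPAdicLFunctionOf f p (-1) L → L.order = ((1 : ℕ) : ℕ∞) := by
  obtain ⟨U₁, _, _, W₀, _, _, h₁, hzU, hns, K, _, _, hK, hHN, hHp, hodd, hlt, hordL⟩ := hU
  obtain ⟨U₂, _, _, hU₂, hiso₂⟩ := exists_zigzag_of_isIsogenous hmodN h₁ hzU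
  exact exists_connectedOrderOneAnchor_of_far_isIsogenous hmodN (p := p) W (isIsogenous_self W) U₂ (hz.trans hU₂) W₀
    hiso₂ hns K hK hHN hHp hodd hlt hordL

/-- **Contrapositive, in the stub's polarity**: if NO non-split order-one anchor is connected to the class of `W` (the fourth
hypothesis of the v11 stub 6⁶ at `W`), then the same holds at every globally minimal `U` with `W ⇝ U`. `hmodN` only. [folklore] -/
theorem not_exists_connectedOrderOneAnchor_of_zigzag (hmodN : nonempty_modularParametrizationData)
    {p : ℕ} [Fact p.Prime] {W : WeierstrassCurve ℚ} [W.IsElliptic] [W.IsGloballyMinimal]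
    (U : WeierstrassCurve ℚ) [U.IsElliptic] [U.IsGloballyMinimal]
    (hz : Relation.ReflTransGen (fun A B : WeierstrassCurve ℚ ↦ TwoStepAt p A B ∨
      (TwoStepAt p B A ∧ ∃ (_ : B.IsElliptic) (_ : B.IsGloballyMinimal), X2.CellB B p)) W U)
    (hW : ¬ ∃ (W₁ : WeierstrassCurve ℚ) (_ : W₁.IsElliptic) (_ : W₁.IsGloballyMinimal)
        (W₀ : WeierstrassCurve ℚ) (_ : W₀.IsElliptic) (_ : W₀.IsGloballyMinimal),
        IsIsogenous W W₁ ∧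
        Relation.ReflTransGen (fun A B : WeierstrassCurve ℚ ↦ TwoStepAt p A B ∨
          (TwoStepAt p B A ∧ ∃ (_ : B.IsElliptic) (_ : B.IsGloballyMinimal), X2.CellB B p)) W₁ W₀ ∧
        ¬ W₀.HasSplitMultiplicativeReductionAtPrime p ∧
        ∃ (K : Type) (_ : Field K) (_ : NumberField K), IsImaginaryQuadratic K ∧
          SatisfiesHeegnerHypothesis (W₀.conductorNorm ℤ) K ∧ SatisfiesHeegnerHypothesis p K ∧
          Odd (NumberField.discr K) ∧ NumberField.discr K < -4 ∧
          ∀ (Wd : WeierstrassCurve ℚ) [Wd.IsElliptic] [Wd.IsGloballyMinimal],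
            (∃ C : VariableChange ℚ, C • Wd = W₀.quadraticTwist (NumberField.discr K : ℚ)) →
            ∀ {M : ℕ} [NeZero M] (f : CuspForm (Gamma0 M) 2), IsNewformOf Wd f →
            ∀ (ϖ : ℚ), (ϖ : ℝ) * Wd.realPeriodRat = plusPeriod f →
            ∀ L : PowerSeries ℚ_[p], IsMultPAdicLFunctionOf f p (-1) L → L.order = ((1 : ℕ) : ℕ∞)) :
    ¬ ∃ (U₁ : WeierstrassCurve ℚ) (_ : U₁.IsElliptic) (_ : U₁.IsGloballyMinimal)
        (W₀ : WeierstrassCurve ℚ) (_ : W₀.IsElliptic) (_ : W₀.IsGloballyMinimal),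
        IsIsogenous U U₁ ∧
        Relation.ReflTransGen (fun A B : WeierstrassCurve ℚ ↦ TwoStepAt p A B ∨
          (TwoStepAt p B A ∧ ∃ (_ : B.IsElliptic) (_ : B.IsGloballyMinimal), X2.CellB B p)) U₁ W₀ ∧
        ¬ W₀.HasSplitMultiplicativeReductionAtPrime p ∧
        ∃ (K : Type) (_ : Field K) (_ : NumberField K), IsImaginaryQuadratic K ∧
          SatisfiesHeegnerHypothesis (W₀.conductorNorm ℤ) K ∧ SatisfiesHeegnerHypothesis p K ∧
          Odd (NumberField.discr K) ∧ NumberField.discr K < -4 ∧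
          ∀ (Wd : WeierstrassCurve ℚ) [Wd.IsElliptic] [Wd.IsGloballyMinimal],
            (∃ C : VariableChange ℚ, C • Wd = W₀.quadraticTwist (NumberField.discr K : ℚ)) →
            ∀ {M : ℕ} [NeZero M] (f : CuspForm (Gamma0 M) 2), IsNewformOf Wd f →
            ∀ (ϖ : ℚ), (ϖ : ℝ) * Wd.realPeriodRat = plusPeriod f →
            ∀ L : PowerSeries ℚ_[p], IsMultPAdicLFunctionOf f p (-1) L → L.order = ((1 : ℕ) : ℕ∞) :=
  fun hU ↦ hW (exists_connectedOrderOneAnchor_of_zigzag hmodN U hz hU)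

/-! ## §4. Mazur's main conjecture from the far-isogenous form of the datum (the v11 cone) -/

/-- **Mazur's main conjecture at an X2b pair `(W, p)` whose class is joined by a zig-zag to the CLASS of a non-split order-one
anchor** — §2 then p675388 §2 (`mazurMainConjectureAt_of_cellB_of_connectedOrderOneAnchor`): the anchor certificate may be
read at ANY globally minimal member `W₀` of the far isogeny class. Named facts BY NAME = the v11 cone: `PublishedInputs`
(its parametrisation conjunct also discharges `hmodN`), Poitou–Tate ×2 (hypotheses), Hsieh, LZZ, Mazur Cor. 4.1, Disegni Thm.
4(1), Disegni Thm. 2.4, Keller–Yin Thm. D (PRE). CONDITIONAL; a main conjecture is proved for no curve; the existence of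
anchors is NOT claimed. [claim: KellerYin2024, status: under-review] [cite: KellerYin2024, Thm. D = Thm. 5.1.3]
[cite: Disegni2020, §2.2 Thm. 2.4 and §3.2 Thm. 4] [cite: PerrinRiou1987, §1.4 Cor. 1.8] [cite: MilneADT2006, Thm. I.7.3] -/
theorem mazurMainConjectureAt_of_cellB_of_zigzag_far_isIsogenous_orderOneAnchor (hP : EisensteinPrimes.PublishedInputs)
    (hPT : ∀ (K : Type) [Field K] [NumberField K], poitouTate_selmerStructure_duality K)
    (hPT2 : ∀ (K : Type) [Field K] [NumberField K], poitouTate_sha_tateDual K)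
    (hH : hsieh2014_exists_anticyclotomicPAdicLFunction)
    (hF : LiuZhangZhang2018.thm151_thm153_modularCurve_heegnerVector) (hMaz : mazur_not_dvd_maninConstant_of_odd)
    (hDis : padicBSD_rankOne_nonsplitMult) (hDGZ : padicGrossZagier_nonsplitMult)
    (hD : KellerYin2024.thmD_imcMult_exists_isBDPLFunction_isTorsion_charIdeal_eq_OPEN)
    (W : WeierstrassCurve ℚ) [W.IsElliptic] [W.IsGloballyMinimal] (p : ℕ) [Fact p.Prime] (hc : X2.CellB W p)
    (W₁ : WeierstrassCurve ℚ) [W₁.IsElliptic] [W₁.IsGloballyMinimal] (hiso₁ : IsIsogenous W W₁)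
    (U : WeierstrassCurve ℚ) [U.IsElliptic] [U.IsGloballyMinimal]
    (hz : Relation.ReflTransGen (fun A B : WeierstrassCurve ℚ ↦ TwoStepAt p A B ∨
      (TwoStepAt p B A ∧ ∃ (_ : B.IsElliptic) (_ : B.IsGloballyMinimal), X2.CellB B p)) W₁ U)
    (W₀ : WeierstrassCurve ℚ) [W₀.IsElliptic] [W₀.IsGloballyMinimal] (hisoU : IsIsogenous U W₀)
    (hns₀ : ¬ W₀.HasSplitMultiplicativeReductionAtPrime p)
    (K : Type) [Field K] [NumberField K] (hK : IsImaginaryQuadratic K)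
    (hHN : SatisfiesHeegnerHypothesis (W₀.conductorNorm ℤ) K) (hHp : SatisfiesHeegnerHypothesis p K)
    (hodd : Odd (NumberField.discr K)) (hlt : NumberField.discr K < -4)
    (hordL : ∀ (Wd : WeierstrassCurve ℚ) [Wd.IsElliptic] [Wd.IsGloballyMinimal],
      (∃ C : VariableChange ℚ, C • Wd = W₀.quadraticTwist (NumberField.discr K : ℚ)) →
      ∀ {M : ℕ} [NeZero M] (f : CuspForm (Gamma0 M) 2), IsNewformOf Wd f →
      ∀ (ϖ : ℚ), (ϖ : ℝ) * Wd.realPeriodRat = plusPeriod f →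
      ∀ L : PowerSeries ℚ_[p], IsMultPAdicLFunctionOf f p (-1) L → L.order = ((1 : ℕ) : ℕ∞)) :
    X2.MazurMainConjectureAt W p :=
  EisensteinPrimesMazurMCOnCellBTwistbackOrderOneAnchorZigzag.mazurMainConjectureAt_of_cellB_of_connectedOrderOneAnchor
    hP hPT hPT2 hH hF hMaz hDis hDGZ hD W p hc
    (exists_connectedOrderOneAnchor_of_far_isIsogenous hP.2.2.2.2.1 (p := p) W₁ hiso₁ U hz W₀ hisoU hns₀ K hK hHN hHp hodd
      hlt hordL)

end Summit.BirchSwinnertonDyer.BirchSwinnertonDyer.Theorems.EisensteinPrimesMazurMCOnCellBTwistbackOrderOneAnchorClassData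

end
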